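import Literature.Probability.LatticeModels.AizenmanWickBoundCouplings
import Literature.Barriers.CriticalPhenomena.IsingTrivialityFromDimensionFour
import HarnessLib

/-!
# The tree diagram bound for general ferromagnetic pair couplings, from the unit-coupling
# finite-graph statement

Topic `Literature/Probability/LatticeModels`. Aizenman's tree diagram bound
`|U₄(x₁,…,x₄)| ≤ 2 ∑_u ∏_j ⟨σ_uσ_{x_j}⟩` (Aizenman 1982; Aizenman CDM 2020, Lemma 8.1, eq. (8.2):
"for the Ising model on any finite graph, at `h = 0` and `β ≥ 0`") is vendored in the tree as the
named fact `Literature.Barriers.CriticalPhenomena.treeDiagramBound` for UNIT couplings on an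
arbitrary finite simple graph (the random-current input of the nearest-neighbour `d ≥ 4` barrier
`IsingTrivialityFromDimensionFour`; consumed at the `LatticeModels` level already by
`HighDimTrivialityTreeBound.lean`). This file PROVES that it implies the tree diagram bound for an
arbitrary nonnegative pair coupling `c` on a finite set `ι` (`PairIsing.abs_ursellFour_le`):

  `|U₄^c(u)| ≤ 2 ∑_{a ∈ ι} ∏_j ⟨σ_aσ_{u_j}⟩_c`.

Unlike the Gaussian inequality and Prop. 12.1 (`GaussianPairingBoundCouplings`,
`AizenmanWickBoundCouplings`), the statement is NOT a pure restriction to site spins: on the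
decorated graph `decorGraph k` the vertex sum also runs over the decoration spins. Summing out one
decoration spin `s` between `a` and `b` with a `σ_s` inserted gives the exact one-site identity
`⟨σ_s Φ(σ|_ι)⟩ = ⟨tanh(β₀(σ_a+σ_b)) Φ⟩_{K(β₀)k} = ½tanh(2β₀)⟨(σ_a+σ_b)Φ⟩_{K(β₀)k}`
(`isingExpect_decorGraph_spin_mul`), so `|⟨σ_sσ_x⟩| ≤ tanh(2β₀)` and the decoration part of the
vertex sum is at most `|Decor k|·tanh⁴(2β₀) ≤ (∑_{a≠b}c_{a,b}) tanh⁴(2β₀)/K(β₀) ≤ 4(∑c) tanh²(2β₀)`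
(`tanh_sq_le_four_mul_decorK`: `tanh²(2β₀) ≤ 4K(β₀)`), which vanishes along the approximating
couplings `K_m⌊c/K_m⌋₊ → c`, `β₀(m) = 1/(m+1) → 0`; the site part and the left side are continuous in
the couplings.

## References

* M. Aizenman, *A geometric perspective on the scaling limits of critical Ising and φ⁴_d models*,
  CDM 2020, Lemma 8.1, eq. (8.2) [AizenmanCDM2020]; M. Aizenman, Comm. Math. Phys. 86 (1982)
  [AizenmanCMP1982] — through `IsingTrivialityFromDimensionFour.lean`.
* R. Panis, arXiv:2309.05797 (2023), §4.2 (tree diagram bound for long-range `J`)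
  [Panis2023Triviality] (the consumer, `LongRangeTrivialityOnZ3TreeBound.lean`).

## Not here

The unit-coupling tree diagram bound itself is NOT proved (random currents). The passage to
`LongRangeIsing.expectIn` / the infinite-volume state on `ℤ^d` is in
`Literature/Barriers/CriticalPhenomena/LongRangeTrivialityOnZ3TreeBound.lean` (planned).
-/

noncomputable section

open MeasureTheory Finset Filter Topology
open scoped Nat

namespace Literature.Probability.LatticeModels

namespace PairIsing

section General

variable {ι : Type*} [Fintype ι] [DecidableEq ι]

/-- `|⟨f⟩_c| ≤ 1` when `|f| ≤ 1`. [folklore] -/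
theorem abs_avg_le_one (c : ι → ι → ℝ) {f : SpinConfig ι → ℝ} (hf : ∀ ρ, |f ρ| ≤ 1) : |avg c f| ≤ 1 := by
  rw [avg, abs_div, abs_of_pos (sum_weight_pos c), div_le_one (sum_weight_pos c)]
  refine (Finset.abs_sum_le_sum_abs _ _).trans (Finset.sum_le_sum fun ρ _ => ?_)
  rw [abs_mul, abs_of_pos (weight_pos c ρ)]
  exact (mul_le_of_le_one_left (weight_pos c ρ).le (hf ρ))

/-- `|⟨σ_aσ_b⟩_c| ≤ 1`. [folklore] -/
theorem abs_avg_spinPair_le_one (c : ι → ι → ℝ) (a b : ι) : |avg c (spinPair a b)| ≤ 1 :=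
  abs_avg_le_one c fun ρ => by rw [spinPair, abs_mul, abs_spinAt, abs_spinAt, one_mul]

/-- **The sign-weighted sum over one decoration spin**: `∑_{w=±1} w e^{β₀w(u+v)} =
tanh(β₀(u+v)) ∑_{w=±1} e^{β₀w(u+v)}`. [folklore] -/
theorem sum_units_spin_exp_decoration (β₀ u v : ℝ) :
    ∑ w : ℤˣ, ((w : ℤ) : ℝ) * Real.exp (β₀ * (((w : ℤ) : ℝ) * u + ((w : ℤ) : ℝ) * v)) =
      Real.tanh (β₀ * (u + v)) * ∑ w : ℤˣ, Real.exp (β₀ * (((w : ℤ) : ℝ) * u + ((w : ℤ) : ℝ) * v)) := by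
  rw [UnitsInt.univ, Finset.sum_insert (by decide), Finset.sum_singleton, Finset.sum_insert (by decide),
    Finset.sum_singleton]
  simp only [Units.val_one, Int.cast_one, Units.val_neg, Int.cast_neg, one_mul, neg_mul]
  rw [show -u + -v = -(u + v) by ring, mul_neg]
  set x : ℝ := β₀ * (u + v) with hx
  have h2 : Real.exp x + Real.exp (-x) ≠ 0 := (add_pos (Real.exp_pos _) (Real.exp_pos _)).ne'
  have key : Real.tanh x * (Real.exp x + Real.exp (-x)) = Real.exp x - Real.exp (-x) := by
    rw [Real.tanh_eq_sinh_div_cosh, Real.sinh_eq, Real.cosh_eq]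
    field_simp
  rw [key]
  ring

/-- For spins `u, v ∈ {±1}`: `tanh(β₀(u+v)) = ½tanh(2β₀)(u+v)`. [folklore] -/
theorem tanh_mul_add_spin (β₀ : ℝ) {u v : ℝ} (hu : u = 1 ∨ u = -1) (hv : v = 1 ∨ v = -1) :
    Real.tanh (β₀ * (u + v)) = Real.tanh (2 * β₀) / 2 * (u + v) := by
  rcases hu with rfl | rfl <;> rcases hv with rfl | rfl
  · rw [show β₀ * (1 + 1) = 2 * β₀ by ring]; ring
  · rw [show β₀ * (1 + -1) = 0 by ring, Real.tanh_zero]; ring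
  · rw [show β₀ * (-1 + 1) = 0 by ring, Real.tanh_zero]; ring
  · rw [show β₀ * (-1 + -1) = -(2 * β₀) by ring, Real.tanh_neg]; ring

/-- `tanh²(2β₀) ≤ 4K(β₀)` (`K = ½log cosh 2β₀`; from `log C ≥ 1 - 1/C` and `tanh² = 1 - 1/cosh²`). [folklore] -/
theorem tanh_sq_le_four_mul_decorK (β₀ : ℝ) : Real.tanh (2 * β₀) ^ 2 ≤ 4 * decorK β₀ := by
  set y : ℝ := 2 * β₀ with hy
  have hC : 0 < Real.cosh y := Real.cosh_pos _
  have hC1 : 1 ≤ Real.cosh y := Real.one_le_cosh _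
  have htanh : Real.tanh y ^ 2 = 1 - (Real.cosh y)⁻¹ ^ 2 := by
    have h := Real.cosh_sq y
    have hc2 : Real.cosh y ^ 2 ≠ 0 := pow_ne_zero _ hC.ne'
    rw [Real.tanh_eq_sinh_div_cosh, div_pow, inv_pow]
    field_simp
    linarith
  have hlog : 1 - (Real.cosh y)⁻¹ ≤ Real.log (Real.cosh y) := by
    have := Real.log_le_sub_one_of_pos (inv_pos.2 hC)
    rw [Real.log_inv] at this
    linarith
  have hinv1 : (Real.cosh y)⁻¹ ≤ 1 := inv_le_one_of_one_le₀ hC1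
  have hinv0 : 0 ≤ (Real.cosh y)⁻¹ := inv_nonneg.2 hC.le
  rw [decorK, ← hy, htanh]
  nlinarith [sq_nonneg (1 - (Real.cosh y)⁻¹)]

/-- Splitting a sum over configurations of `ι ⊕ κ`. [folklore] -/
theorem sum_cfg_sum_split {κ : Type*} [Fintype κ] [DecidableEq κ] (F : SpinConfig (ι ⊕ κ) → ℝ) :
    ∑ σ : SpinConfig (ι ⊕ κ), F σ = ∑ ρ : SpinConfig ι, ∑ η : SpinConfig κ, F (Sum.elim ρ η) := by
  rw [← Fintype.sum_prod_type']
  refine Fintype.sum_equiv (Equiv.sumArrowEquivProdArrow ι κ ℤˣ) _ _ fun σ => ?_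
  show F σ = F (Sum.elim (σ ∘ Sum.inl) (σ ∘ Sum.inr))
  rw [Sum.elim_comp_inl_inr]

/-- **Summing out the decorations with one decoration spin inserted.** For `Φ` a function of the
site spins and a decoration `s₀` between `a₀ = s₀.1` and `b₀ = s₀.2.1`:
`∑_σ Φ(σ|_ι) σ_{s₀} e^{β₀∑_eσ_e} = (2e^K)^{|Decor k|} ∑_ρ Φ(ρ) tanh(β₀(ρ_{a₀}+ρ_{b₀})) w_{Kk}(ρ)`.
[folklore] -/
theorem sum_cfg_decor_spin_eq {k : ι → ι → ℕ} (hk : ∀ a, k a a = 0) (β₀ : ℝ) (s₀ : Decor k)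
    (Φ : SpinConfig ι → ℝ) :
    ∑ σ : SpinConfig (ι ⊕ Decor k), Φ (σ ∘ Sum.inl) * spinAt (Sum.inr s₀) σ *
        Real.exp (β₀ * ∑ e ∈ (decorGraph k).edgeFinset, bondSpin σ e) =
      (2 * Real.exp (decorK β₀)) ^ Fintype.card (Decor k) *
        ∑ ρ : SpinConfig ι, Φ ρ * Real.tanh (β₀ * (spinAt s₀.1 ρ + spinAt s₀.2.1 ρ)) *
          weight (fun a b => decorK β₀ * k a b) ρ := by
  classical
  -- the right-hand side is the plain marginal of `Φ'(ρ) = Φ(ρ) tanh(β₀(ρ_{a₀}+ρ_{b₀}))`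
  have hR := sum_cfg_decor_eq hk β₀ (fun ρ => Φ ρ * Real.tanh (β₀ * (spinAt s₀.1 ρ + spinAt s₀.2.1 ρ)))
  rw [← hR, sum_cfg_sum_split, sum_cfg_sum_split]
  refine Finset.sum_congr rfl fun ρ _ => ?_
  simp only [Sum.elim_comp_inl]
  -- the inner sums over the decoration spins
  set f : Decor k → ℤˣ → ℝ := fun t w =>
    Real.exp (β₀ * (((w : ℤ) : ℝ) * spinAt t.1 ρ + ((w : ℤ) : ℝ) * spinAt t.2.1 ρ)) with hf
  have h1 : ∀ η : SpinConfig (Decor k),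
      Real.exp (β₀ * ∑ e ∈ (decorGraph k).edgeFinset, bondSpin (Sum.elim ρ η) e) = ∏ t : Decor k, f t (η t) := by
    intro η
    rw [sum_edgeFinset_bondSpin_decor hk, Finset.mul_sum, Real.exp_sum]
    rfl
  have hspin : ∀ η : SpinConfig (Decor k), spinAt (Sum.inr s₀) (Sum.elim ρ η) = (((η s₀ : ℤ) : ℝ)) := fun η => rfl
  simp_rw [h1, hspin]
  -- `η_{s₀} ∏_t f_t(η_t) = ∏_t g_t(η_t)` with the sign absorbed in the factor `t = s₀`
  set g : Decor k → ℤˣ → ℝ := fun t w => (if t = s₀ then (((w : ℤ) : ℝ)) else 1) * f t w with hg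
  have hprod : ∀ η : SpinConfig (Decor k), (((η s₀ : ℤ) : ℝ)) * ∏ t, f t (η t) = ∏ t, g t (η t) := by
    intro η
    rw [hg]
    simp only
    rw [Finset.prod_mul_distrib, Finset.prod_ite_eq']
    simp
  have hsum_g : ∀ t : Decor k, ∑ w : ℤˣ, g t w =
      (if t = s₀ then Real.tanh (β₀ * (spinAt s₀.1 ρ + spinAt s₀.2.1 ρ)) else 1) * ∑ w : ℤˣ, f t w := by
    intro t
    by_cases ht : t = s₀
    · subst ht
      simp only [hg, if_true]
      exact sum_units_spin_exp_decoration β₀ _ _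
    · simp only [hg, if_neg ht, one_mul]
  calc ∑ η : SpinConfig (Decor k), Φ ρ * (((η s₀ : ℤ) : ℝ)) * ∏ t, f t (η t)
      = Φ ρ * ∑ η : Decor k → ℤˣ, ∏ t, g t (η t) := by
        rw [Finset.mul_sum]
        exact Finset.sum_congr rfl fun η _ => by rw [mul_assoc, hprod]
    _ = Φ ρ * ∏ t, ∑ w : ℤˣ, g t w := by rw [Fintype.prod_sum]
    _ = Φ ρ * (Real.tanh (β₀ * (spinAt s₀.1 ρ + spinAt s₀.2.1 ρ)) * ∏ t, ∑ w : ℤˣ, f t w) := by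
        simp_rw [hsum_g]
        rw [Finset.prod_mul_distrib, Finset.prod_ite_eq']
        simp
    _ = ∑ η : SpinConfig (Decor k), Φ ρ * Real.tanh (β₀ * (spinAt s₀.1 ρ + spinAt s₀.2.1 ρ)) * ∏ t, f t (η t) := by
        rw [Fintype.prod_sum, ← mul_assoc, Finset.mul_sum]

/-- **One-site conditional expectation of a decoration spin**: for every observable `Φ` of the site
spins, `⟨σ_{s₀} Φ(σ|_ι)⟩^{free}_{decorGraph k;β₀,0} = ⟨tanh(β₀(σ_{a₀}+σ_{b₀})) Φ⟩_{K(β₀)k}`. [folklore] -/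
theorem isingExpect_decorGraph_spin_mul {k : ι → ι → ℕ} (hk : ∀ a, k a a = 0) (β₀ : ℝ) (s₀ : Decor k)
    (Φ : SpinConfig ι → ℝ) :
    isingExpect (decorGraph k) univ β₀ 0 .free (fun σ => spinAt (Sum.inr s₀) σ * Φ (σ ∘ Sum.inl)) =
      avg (fun a b => decorK β₀ * k a b)
        (fun ρ => Real.tanh (β₀ * (spinAt s₀.1 ρ + spinAt s₀.2.1 ρ)) * Φ ρ) := by
  classical
  rw [isingExpect_univ_free_eq_sum_div, avg]
  have hnum := sum_cfg_decor_spin_eq hk β₀ s₀ Φ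
  have hden := sum_cfg_decor_eq hk β₀ (fun _ => (1 : ℝ))
  simp only [one_mul] at hden
  rw [show ∑ σ : SpinConfig (ι ⊕ Decor k), spinAt (Sum.inr s₀) σ * Φ (σ ∘ Sum.inl) *
        Real.exp (β₀ * ∑ e ∈ (decorGraph k).edgeFinset, bondSpin σ e) =
      ∑ σ : SpinConfig (ι ⊕ Decor k), Φ (σ ∘ Sum.inl) * spinAt (Sum.inr s₀) σ *
        Real.exp (β₀ * ∑ e ∈ (decorGraph k).edgeFinset, bondSpin σ e) from
      Finset.sum_congr rfl fun σ _ => by ring, hnum, hden,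
    mul_div_mul_left _ _ (pow_ne_zero _ (mul_ne_zero two_ne_zero (Real.exp_pos _).ne'))]
  congr 1
  exact Finset.sum_congr rfl fun ρ _ => by ring

/-- **Site–decoration two-point functions of the decorated model**:
`⟨σ_sσ_b⟩ = ½tanh(2β₀)(⟨σ_{s.1}σ_b⟩_{Kk} + ⟨σ_{s.2.1}σ_b⟩_{Kk})`. [folklore] -/
theorem twoPoint_decorGraph_inr_inl {k : ι → ι → ℕ} (hk : ∀ a, k a a = 0) (β₀ : ℝ) (s : Decor k) (b : ι) :
    twoPoint (isingMeasure (decorGraph k) univ β₀ 0 .free) spinAt (Sum.inr s) (Sum.inl b) =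
      Real.tanh (2 * β₀) / 2 *
        (avg (fun a b => decorK β₀ * k a b) (spinPair s.1 b) + avg (fun a b => decorK β₀ * k a b) (spinPair s.2.1 b)) := by
  have h := isingExpect_decorGraph_spin_mul hk β₀ s (spinAt b)
  have h' : twoPoint (isingMeasure (decorGraph k) univ β₀ 0 .free) spinAt (Sum.inr s) (Sum.inl b) =
      isingExpect (decorGraph k) univ β₀ 0 .free (fun σ => spinAt (Sum.inr s) σ * spinAt b (σ ∘ Sum.inl)) := rfl
  rw [h', h, ← avg_add, ← avg_const_mul]
  congr 1
  funext ρ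
  rw [tanh_mul_add_spin β₀ (spinAt_eq_one_or_eq_neg_one _ _) (spinAt_eq_one_or_eq_neg_one _ _), spinPair, spinPair]
  ring

/-- `|⟨σ_sσ_b⟩| ≤ |tanh 2β₀|` for a decoration `s` and a site `b`. [folklore] -/
theorem abs_twoPoint_decorGraph_inr_inl_le {k : ι → ι → ℕ} (hk : ∀ a, k a a = 0) (β₀ : ℝ) (s : Decor k) (b : ι) :
    |twoPoint (isingMeasure (decorGraph k) univ β₀ 0 .free) spinAt (Sum.inr s) (Sum.inl b)| ≤ |Real.tanh (2 * β₀)| := by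
  rw [twoPoint_decorGraph_inr_inl hk, abs_mul, abs_div, abs_two]
  have h1 := abs_avg_spinPair_le_one (fun a b => decorK β₀ * k a b) s.1 b
  have h2 := abs_avg_spinPair_le_one (fun a b => decorK β₀ * k a b) s.2.1 b
  have h3 := abs_add_le (avg (fun a b => decorK β₀ * k a b) (spinPair s.1 b))
    (avg (fun a b => decorK β₀ * k a b) (spinPair s.2.1 b))
  have h0 : 0 ≤ |Real.tanh (2 * β₀)| := abs_nonneg _
  nlinarith

omit [DecidableEq ι] in
/-- `|Decor k| = ∑_{a,b} k a b`. [folklore] -/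
theorem card_decor (k : ι → ι → ℕ) : Fintype.card (Decor k) = ∑ a, ∑ b, k a b := by
  rw [Fintype.card_sigma]
  refine Finset.sum_congr rfl fun a _ => ?_
  rw [Fintype.card_sigma]
  exact Finset.sum_congr rfl fun b _ => Fintype.card_fin _

end General

section UnitCoupling

variable {ι : Type} [Fintype ι] [DecidableEq ι]

/-- **Tree diagram bound for decorated couplings, with the decoration error term**: granted the
unit-coupling finite-graph tree diagram bound, for `k` integer with zero diagonal and `β₀ ≥ 0`,
`|U₄^{Kk}(u)| ≤ 2∑_a ∏_j⟨σ_aσ_{u_j}⟩_{Kk} + 2|Decor k|·tanh⁴(2β₀)` (the vertex sum over the decoration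
spins bounded through `abs_twoPoint_decorGraph_inr_inl_le`). [cite: AizenmanCDM2020, Lemma 8.1, eq. (8.2)] -/
theorem abs_ursellFour_le_decor (hTB : Literature.Barriers.CriticalPhenomena.treeDiagramBound)
    {k : ι → ι → ℕ} (hk : ∀ a, k a a = 0) {β₀ : ℝ} (hβ₀ : 0 ≤ β₀) (u : Fin 4 → ι) :
    |ursellFour (fun a b => decorK β₀ * k a b) u| ≤
      2 * ∑ a, ∏ j, avg (fun a b => decorK β₀ * k a b) (spinPair a (u j)) +
        2 * Fintype.card (Decor k) * |Real.tanh (2 * β₀)| ^ 4 := by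
  classical
  have h := hTB (ι ⊕ Decor k) (decorGraph k) β₀ hβ₀ (Sum.inl ∘ u)
  rw [connectedFour_decorGraph_inl hk, Fintype.sum_sum_type, mul_add] at h
  have hsite : ∀ a : ι, ∏ j, isingTwoPoint (decorGraph k) univ β₀ 0 .free (Sum.inl a) ((Sum.inl ∘ u) j) =
      ∏ j, avg (fun a b => decorK β₀ * k a b) (spinPair a (u j)) :=
    fun a => Finset.prod_congr rfl fun j _ => twoPoint_decorGraph_inl hk β₀ a (u j)
  have hdec : ∀ s : Decor k, ∏ j, isingTwoPoint (decorGraph k) univ β₀ 0 .free (Sum.inr s) ((Sum.inl ∘ u) j) ≤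
      |Real.tanh (2 * β₀)| ^ 4 := by
    intro s
    refine (le_abs_self _).trans ?_
    rw [Finset.abs_prod, show |Real.tanh (2 * β₀)| ^ 4 = ∏ _j : Fin 4, |Real.tanh (2 * β₀)| by
      rw [Finset.prod_const, Finset.card_univ, Fintype.card_fin]]
    exact Finset.prod_le_prod (fun j _ => abs_nonneg _) fun j _ => abs_twoPoint_decorGraph_inr_inl_le hk β₀ s (u j)
  simp_rw [hsite] at h
  refine h.trans (add_le_add le_rfl ?_)
  rw [mul_assoc]
  refine mul_le_mul_of_nonneg_left ?_ zero_le_two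
  calc ∑ s : Decor k, ∏ j, isingTwoPoint (decorGraph k) univ β₀ 0 .free (Sum.inr s) ((Sum.inl ∘ u) j)
      ≤ ∑ _s : Decor k, |Real.tanh (2 * β₀)| ^ 4 := Finset.sum_le_sum fun s _ => hdec s
    _ = Fintype.card (Decor k) * |Real.tanh (2 * β₀)| ^ 4 := by
        rw [Finset.sum_const, Finset.card_univ, nsmul_eq_mul]

/-- **The tree diagram bound for a general ferromagnetic pair interaction on a finite set, granted
its unit-coupling finite-graph form**: for off-diagonal couplings `c_{a,b} ≥ 0` and any four sites
(repetitions allowed), `|U₄^c(u₀,u₁,u₂,u₃)| ≤ 2 ∑_a ∏_j ⟨σ_aσ_{u_j}⟩_c` (Aizenman 1982; CDM 2020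
Lemma 8.1: "for the Ising model on any finite graph" — here any finite ferromagnetic pair
interaction). Decorated couplings `K_m⌊c/K_m⌋₊ → c` with `β₀ = 1/(m+1)`; the decoration error
`2|Decor|tanh⁴ ≤ 8(∑c)tanh²(2β₀) → 0`; continuity of the remaining terms.
[cite: AizenmanCDM2020, Lemma 8.1, eq. (8.2)] -/
theorem abs_ursellFour_le (hTB : Literature.Barriers.CriticalPhenomena.treeDiagramBound) (c : ι → ι → ℝ)
    (hc : ∀ a b, a ≠ b → 0 ≤ c a b) (u : Fin 4 → ι) :
    |ursellFour c u| ≤ 2 * ∑ a, ∏ j, avg c (spinPair a (u j)) := by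
  classical
  set β₀ : ℕ → ℝ := fun m => 1 / ((m : ℝ) + 1) with hβ₀
  set K : ℕ → ℝ := fun m => decorK (β₀ m) with hK
  set kn : ℕ → ι → ι → ℕ := fun m a b => if a = b then 0 else ⌊c a b / K m⌋₊ with hkn
  set cn : ℕ → ι → ι → ℝ := fun m a b => K m * (kn m a b : ℝ) with hcn
  set Ctot : ℝ := ∑ a, ∑ b, offDiag c a b with hCtot
  have hβ₀pos : ∀ m, 0 < β₀ m := fun m => by positivity
  have hKpos : ∀ m, 0 < K m := fun m => decorK_pos (hβ₀pos m).ne'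
  have hkn0 : ∀ m a, kn m a a = 0 := fun m a => by simp [hkn]
  have hconv : Tendsto cn atTop (𝓝 (offDiag c)) := by
    rw [tendsto_pi_nhds]
    intro a
    rw [tendsto_pi_nhds]
    intro b
    by_cases hab : a = b
    · simp only [hcn, hkn, offDiag, if_pos hab, Nat.cast_zero, mul_zero]
      exact tendsto_const_nhds
    · simp only [hcn, hkn, hK, hβ₀, offDiag, if_neg hab]
      exact tendsto_decorK_mul_floor (hc a b hab)
  -- the decoration error
  have hcard : ∀ m, (Fintype.card (Decor (kn m)) : ℝ) * K m ≤ Ctot := by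
    intro m
    rw [card_decor, hCtot, Nat.cast_sum, Finset.sum_mul]
    refine Finset.sum_le_sum fun a _ => ?_
    rw [Nat.cast_sum, Finset.sum_mul]
    refine Finset.sum_le_sum fun b _ => ?_
    by_cases hab : a = b
    · simp [hkn, offDiag, hab]
    · simp only [hkn, offDiag, if_neg hab]
      have h1 := Nat.floor_le (div_nonneg (hc a b hab) (hKpos m).le)
      have := mul_le_mul_of_nonneg_right h1 (hKpos m).le
      rwa [div_mul_cancel₀ _ (hKpos m).ne'] at this
  have herr : ∀ m, 2 * (Fintype.card (Decor (kn m)) : ℝ) * |Real.tanh (2 * β₀ m)| ^ 4 ≤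
      8 * Ctot * Real.tanh (2 * β₀ m) ^ 2 := by
    intro m
    have ht := tanh_sq_le_four_mul_decorK (β₀ m)
    have hcK := hcard m
    have h0 : (0 : ℝ) ≤ Fintype.card (Decor (kn m)) := Nat.cast_nonneg _
    have ht0 : 0 ≤ Real.tanh (2 * β₀ m) ^ 2 := sq_nonneg _
    rw [show |Real.tanh (2 * β₀ m)| ^ 4 = Real.tanh (2 * β₀ m) ^ 2 * Real.tanh (2 * β₀ m) ^ 2 by
      rw [← sq_abs (Real.tanh _)]; ring]
    calc 2 * (Fintype.card (Decor (kn m)) : ℝ) * (Real.tanh (2 * β₀ m) ^ 2 * Real.tanh (2 * β₀ m) ^ 2)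
        ≤ 2 * (Fintype.card (Decor (kn m)) : ℝ) * (4 * K m * Real.tanh (2 * β₀ m) ^ 2) := by
          apply mul_le_mul_of_nonneg_left _ (by positivity)
          exact mul_le_mul_of_nonneg_right ht ht0
      _ = 8 * ((Fintype.card (Decor (kn m)) : ℝ) * K m) * Real.tanh (2 * β₀ m) ^ 2 := by ring
      _ ≤ 8 * Ctot * Real.tanh (2 * β₀ m) ^ 2 := by
          apply mul_le_mul_of_nonneg_right _ ht0
          exact mul_le_mul_of_nonneg_left hcK (by norm_num)
  -- the inequality along the sequence
  have hineq : ∀ m, |ursellFour (cn m) u| ≤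
      2 * ∑ a, ∏ j, avg (cn m) (spinPair a (u j)) + 8 * Ctot * Real.tanh (2 * β₀ m) ^ 2 :=
    fun m => (abs_ursellFour_le_decor hTB (hkn0 m) (hβ₀pos m).le u).trans (add_le_add le_rfl (herr m))
  -- limits
  have havg : ∀ f : SpinConfig ι → ℝ, Tendsto (fun m => avg (cn m) f) atTop (𝓝 (avg (offDiag c) f)) :=
    fun f => ((continuous_avg f).tendsto _).comp hconv
  have hl : Tendsto (fun m => |ursellFour (cn m) u|) atTop (𝓝 |ursellFour (offDiag c) u|) :=
    (((continuous_ursellFour u).tendsto _).comp hconv).abs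
  have htanh0 : Tendsto (fun m => Real.tanh (2 * β₀ m)) atTop (𝓝 0) := by
    have h2 : Tendsto (fun m => 2 * β₀ m) atTop (𝓝 0) := by
      have := (tendsto_one_div_add_atTop_nhds_zero_nat.const_mul (2 : ℝ))
      rw [mul_zero] at this
      exact this
    have hc : Continuous Real.tanh := by
      rw [show Real.tanh = fun x => Real.sinh x / Real.cosh x from funext Real.tanh_eq_sinh_div_cosh]
      exact Real.continuous_sinh.div Real.continuous_cosh fun x => (Real.cosh_pos x).ne'
    have h3 := (hc.tendsto 0).comp h2
    rw [Real.tanh_zero] at h3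
    exact h3
  have hr : Tendsto (fun m => 2 * ∑ a, ∏ j, avg (cn m) (spinPair a (u j)) + 8 * Ctot * Real.tanh (2 * β₀ m) ^ 2)
      atTop (𝓝 (2 * ∑ a, ∏ j, avg (offDiag c) (spinPair a (u j)) + 8 * Ctot * 0 ^ 2)) :=
    ((tendsto_finsetSum _ fun a _ => tendsto_finsetProd _ fun j _ => havg _).const_mul _).add
      ((htanh0.pow 2).const_mul _)
  have hlim := le_of_tendsto_of_tendsto' hl hr hineq
  simp only [ne_eq, OfNat.ofNat_ne_zero, not_false_eq_true, zero_pow, mul_zero, add_zero] at hlim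
  simpa only [avg_offDiag, ursellFour_offDiag_eq] using hlim

end UnitCoupling

end PairIsing

end Literature.Probability.LatticeModels

end
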